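import Summits.QuantumFields.GaugeBoot.TiltedBoxRedLinkTube
import Summits.QuantumFields.GaugeBoot.TiltedBoxRedSiteCup
import HarnessLib

/-!
# The reduced half of the link mirror of the odd square tilted box: gluing the cup (gauge-boot, L3 supplement: reduced-half in-plane mirrors, 6a/7)

HONEST FRAMING (cell `pub-gaugeboot`, page 1 of every file): the venture produces certified bounds
on lattice expectations at stated coupling, gauge group, dimension and torus size; NOT a mass gap,
NOT a continuum limit, NOT a string tension; NOT Yang–Mills-summit-bearing (barriers
`FixedCouplingUltralocality`, `PerturbativeInvisibility`). This module is bookkeeping for a small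
structural NEGATIVE result (the REDUCED-half in-plane mirrors of the square tilted boxes are not of
positive type in `d ≥ 3` at small coupling); it discharges nothing by itself.

## Content (odd box, `P ≥ 2`, `L ≥ 2`, compact metrisable `G`, continuous `ρ` with the character identity (R1) `∫ Re χ(x g⁻¹) Re χ(g y) dg = c₁ Re χ(x y)`)

The product-Haar integral of the CUP — a transverse plaquette `v = (z; q)` (`q₁, q₂ ≠ i`) together
with the four standing plaquettes on its links — against any continuous factor `R` not reading the
links of `v`:

  `∫ W_v · W_{S₀} W_{S₁} W_{S₂} W_{S₃} · R ∏ dU = c₁⁴ ∫ W_{v + e_i} · R ∏ dU`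

(`W = Re tr ρ(U_·)`, `v + e_i` the RING plaquette one layer up): this file proves the four one-link
steps ★ `glueA`–`glueD` (each an instance of (R1) after a cyclic rotation / inversion of one word; the
rungs cancel and the last rung drops by conjugation invariance); the assembled cup identity is
`integral_cup_eq` in `TiltedBoxRedLinkCupIntegral.lean`. This is the folklore strong-coupling gluing
(M. Creutz, *Quarks, gluons and lattices* (1983) Ch. 8) written on the tilted box; with it the tube
term is evaluated in `TiltedBoxRedLinkTubeValue.lean`.
-/

noncomputable section

open QuotientAddGroup Finset Function MeasureTheory
open Literature.MathematicalPhysics.QuantumFieldTheory (haarProbability)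
open Literature.MathematicalPhysics.QuantumFieldTheory.PlaquetteLowerBound (reTr)
open Literature.RepresentationTheory.CompactGroups

namespace Summit.QuantumFields.GaugeBoot

namespace TiltedRP

namespace RedLink

variable {d : ℕ} {i j : Fin d} {L P N : ℕ} [NeZero L] [NeZero P]
  [DecidableEq (TiltedSite d i j (2 * P + 1) (2 * P + 1) L)]
variable {G : Type*} [Group G] [TopologicalSpace G] [IsTopologicalGroup G] [CompactSpace G]
  [MeasurableSpace G] [BorelSpace G] [SecondCountableTopology G]
variable (ρ : G →* Matrix (Fin N) (Fin N) ℂ) (q : DirPair d)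

/-! ## Explicit holonomies -/

omit [NeZero L] [NeZero P] [DecidableEq (TiltedSite d i j (2 * P + 1) (2 * P + 1) L)] [MeasurableSpace G] [BorelSpace G]
  [SecondCountableTopology G] in
/-- **The standing plaquette on `(x, m)` reads `Re tr ρ(U(x,i) U(x+e_i,m) U(x+e_m,i)⁻¹ U(x,m)⁻¹)`**
(in either order of the pair `{i, m}`, by `Re tr ρ(g⁻¹) = Re tr ρ(g)`). [folklore] -/
theorem plaqObs_stand_eq (hρ : Continuous ρ) (x : TiltedSite d i j (2 * P + 1) (2 * P + 1) L) {m : Fin d} (hm : m ≠ i)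
    (U : Config (TiltedSite d i j (2 * P + 1) (2 * P + 1) L) d G) :
    plaqObs ρ (tiltedUnit d i j (2 * P + 1) (2 * P + 1) L) (stand q (x, m)) U =
      reTr ρ (U (x, i) * U (x + tiltedUnit d i j (2 * P + 1) (2 * P + 1) L i, m) *
        (U (x + tiltedUnit d i j (2 * P + 1) (2 * P + 1) L m, i))⁻¹ * (U (x, m))⁻¹) := by
  unfold stand stdDir plaqObs holonomy
  by_cases h : i < m
  · rw [dif_pos h]; rfl
  · rw [dif_neg h, dif_pos (lt_of_le_of_ne (not_lt.1 h) hm)]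
    show reTr ρ _ = reTr ρ _
    rw [show U (x, m) * U (x + tiltedUnit d i j (2 * P + 1) (2 * P + 1) L m, i) *
        (U (x + tiltedUnit d i j (2 * P + 1) (2 * P + 1) L i, m))⁻¹ * (U (x, i))⁻¹ =
        (U (x, i) * U (x + tiltedUnit d i j (2 * P + 1) (2 * P + 1) L i, m) *
          (U (x + tiltedUnit d i j (2 * P + 1) (2 * P + 1) L m, i))⁻¹ * (U (x, m))⁻¹)⁻¹ by group]
    exact CompactGroup.re_trace_map_inv ρ hρ _

omit [NeZero L] [NeZero P] [DecidableEq (TiltedSite d i j (2 * P + 1) (2 * P + 1) L)] [TopologicalSpace G]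
  [IsTopologicalGroup G] [CompactSpace G] [MeasurableSpace G] [BorelSpace G] [SecondCountableTopology G] in
/-- The transverse plaquette `(x; q)` reads `Re tr ρ(U(x,q₁) U(x+e_{q₁},q₂) U(x+e_{q₂},q₁)⁻¹ U(x,q₂)⁻¹)`.
[folklore] -/
theorem plaqObs_transverse_eq (x : TiltedSite d i j (2 * P + 1) (2 * P + 1) L) (U : Config (TiltedSite d i j (2 * P + 1) (2 * P + 1) L) d G) :
    plaqObs ρ (tiltedUnit d i j (2 * P + 1) (2 * P + 1) L) (x, q) U =
      reTr ρ (U (x, q.1.1) * U (x + tiltedUnit d i j (2 * P + 1) (2 * P + 1) L q.1.1, q.1.2) *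
        (U (x + tiltedUnit d i j (2 * P + 1) (2 * P + 1) L q.1.2, q.1.1))⁻¹ * (U (x, q.1.2))⁻¹) := rfl

omit [NeZero L] [NeZero P] [DecidableEq (TiltedSite d i j (2 * P + 1) (2 * P + 1) L)] in
/-- Links based one layer apart are distinct: `(x + e_i, m) ≠ (x, m')`-type facts, read through
`axisCoord`. [folklore] -/
theorem link_ne_of_axisCoord_ne {x y : TiltedSite d i j (2 * P + 1) (2 * P + 1) L} {m m' : Fin d}
    (h : axisCoord d L (2 * P + 1) x ≠ axisCoord d L (2 * P + 1) y) : ((x, m) : Link _ d) ≠ (y, m') :=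
  fun h' => h (by rw [(Prod.mk.inj h').1])

omit [NeZero L] [NeZero P] [DecidableEq (TiltedSite d i j (2 * P + 1) (2 * P + 1) L)] in
/-- `x + e_i` and `x` lie in different layers (`P ≥ 2`). [folklore] -/
theorem axisCoord_add_self_ne (hP : 2 ≤ P) (x : TiltedSite d i j (2 * P + 1) (2 * P + 1) L) :
    axisCoord d L (2 * P + 1) (x + tiltedUnit d i j (2 * P + 1) (2 * P + 1) L i) ≠ axisCoord d L (2 * P + 1) x := by
  rw [map_add, axisCoord_tiltedUnit_self]
  intro h
  have h1 : (1 : ZMod (2 * P + 1)) = 0 := by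
    have := congrArg (fun a => a - axisCoord d L (2 * P + 1) x) h
    simpa using this
  have h2 := congrArg ZMod.val h1
  rw [ZMod.val_one'' (by omega : 2 * P + 1 ≠ 1), ZMod.val_zero] at h2
  exact one_ne_zero h2

/-! ## The four gluing steps -/

section Glue

variable (z : TiltedSite d i j (2 * P + 1) (2 * P + 1) L)

/-- The word after gluing `S₀` into `v` along `(z, q₁)`. [folklore] -/
def wA (U : Config (TiltedSite d i j (2 * P + 1) (2 * P + 1) L) d G) : ℝ :=
  reTr ρ (U (z, i) * U (z + tiltedUnit d i j (2 * P + 1) (2 * P + 1) L i, q.1.1) *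
    (U (z + tiltedUnit d i j (2 * P + 1) (2 * P + 1) L q.1.1, i))⁻¹ *
    U (z + tiltedUnit d i j (2 * P + 1) (2 * P + 1) L q.1.1, q.1.2) *
    (U (z + tiltedUnit d i j (2 * P + 1) (2 * P + 1) L q.1.2, q.1.1))⁻¹ * (U (z, q.1.2))⁻¹)

/-- The word after gluing `S₁` along `(z + e_{q₁}, q₂)` (the rung `U(z+e_{q₁},i)` conjugated away).
[folklore] -/
def wB (U : Config (TiltedSite d i j (2 * P + 1) (2 * P + 1) L) d G) : ℝ :=
  reTr ρ (U (z + tiltedUnit d i j (2 * P + 1) (2 * P + 1) L q.1.1 + tiltedUnit d i j (2 * P + 1) (2 * P + 1) L i, q.1.2) *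
    (U (z + tiltedUnit d i j (2 * P + 1) (2 * P + 1) L q.1.1 + tiltedUnit d i j (2 * P + 1) (2 * P + 1) L q.1.2, i))⁻¹ *
    (U (z + tiltedUnit d i j (2 * P + 1) (2 * P + 1) L q.1.2, q.1.1))⁻¹ * (U (z, q.1.2))⁻¹ * U (z, i) * U (z + tiltedUnit d i j (2 * P + 1) (2 * P + 1) L i, q.1.1))

/-- The word after gluing `S₂` along `(z + e_{q₂}, q₁)`. [folklore] -/
def wC (U : Config (TiltedSite d i j (2 * P + 1) (2 * P + 1) L) d G) : ℝ :=
  reTr ρ ((U (z, q.1.2))⁻¹ * U (z, i) * U (z + tiltedUnit d i j (2 * P + 1) (2 * P + 1) L i, q.1.1) *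
    U (z + tiltedUnit d i j (2 * P + 1) (2 * P + 1) L q.1.1 + tiltedUnit d i j (2 * P + 1) (2 * P + 1) L i, q.1.2) *
    (U (z + tiltedUnit d i j (2 * P + 1) (2 * P + 1) L q.1.2 + tiltedUnit d i j (2 * P + 1) (2 * P + 1) L i, q.1.1))⁻¹ *
    (U (z + tiltedUnit d i j (2 * P + 1) (2 * P + 1) L q.1.2, i))⁻¹)

variable {c₁ : ℝ}
  (hR1 : ∀ x y : G, ∫ g, reTr ρ (x * g⁻¹) * reTr ρ (g * y) ∂haarProbability G = c₁ * reTr ρ (x * y))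

omit [NeZero L] [NeZero P] [SecondCountableTopology G] in
include hR1 in
/-- **Step A**: integrating the link `(z, q₁)` glues `S₀` into `v`. [folklore] -/
theorem glueA (hP : 2 ≤ P) (hij : i ≠ j) (hL : 2 ≤ L) (hq1 : q.1.1 ≠ i) (hρ : Continuous ρ)
    (U : Config (TiltedSite d i j (2 * P + 1) (2 * P + 1) L) d G) :
    ∫ s, plaqObs ρ (tiltedUnit d i j (2 * P + 1) (2 * P + 1) L) (z, q) (update U (z, q.1.1) s) *
        plaqObs ρ (tiltedUnit d i j (2 * P + 1) (2 * P + 1) L) (stand q (z, q.1.1)) (update U (z, q.1.1) s)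
        ∂haarProbability G = c₁ * wA ρ q z U := by
  have hq12 : q.1.1 ≠ q.1.2 := ne_of_lt q.2
  have he := tiltedUnit_ne_zero_all (d := d) hP hij hL
  have n1 : ((z + tiltedUnit d i j (2 * P + 1) (2 * P + 1) L q.1.1, q.1.2) : Link _ d) ≠ (z, q.1.1) := fun h => hq12 (Prod.mk.inj h).2.symm
  have n2 : ((z + tiltedUnit d i j (2 * P + 1) (2 * P + 1) L q.1.2, q.1.1) : Link _ d) ≠ (z, q.1.1) := fun h =>
    he _ (by simpa using (Prod.mk.inj h).1)
  have n3 : ((z, q.1.2) : Link _ d) ≠ (z, q.1.1) := fun h => hq12 (Prod.mk.inj h).2.symm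
  have n4 : ((z, i) : Link _ d) ≠ (z, q.1.1) := fun h => hq1 (Prod.mk.inj h).2.symm
  have n5 : ((z + tiltedUnit d i j (2 * P + 1) (2 * P + 1) L i, q.1.1) : Link _ d) ≠ (z, q.1.1) :=
    link_ne_of_axisCoord_ne (axisCoord_add_self_ne hP z)
  have n6 : ((z + tiltedUnit d i j (2 * P + 1) (2 * P + 1) L q.1.1, i) : Link _ d) ≠ (z, q.1.1) := fun h => hq1 (Prod.mk.inj h).2.symm
  simp_rw [plaqObs_transverse_eq, plaqObs_stand_eq ρ q hρ z hq1, update_self, update_of_ne n1, update_of_ne n2,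
    update_of_ne n3, update_of_ne n4, update_of_ne n5, update_of_ne n6]
  simp_rw [show ∀ s : G, s * U (z + tiltedUnit d i j (2 * P + 1) (2 * P + 1) L q.1.1, q.1.2) *
      (U (z + tiltedUnit d i j (2 * P + 1) (2 * P + 1) L q.1.2, q.1.1))⁻¹ * (U (z, q.1.2))⁻¹ =
      s * (U (z + tiltedUnit d i j (2 * P + 1) (2 * P + 1) L q.1.1, q.1.2) *
        (U (z + tiltedUnit d i j (2 * P + 1) (2 * P + 1) L q.1.2, q.1.1))⁻¹ * (U (z, q.1.2))⁻¹) from fun s => by group]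
  rw [RedSite.integral_reTr_swap ρ hR1]
  unfold wA
  congr 2
  group

omit [NeZero L] [NeZero P] [SecondCountableTopology G] in
include hR1 in
/-- **Step B**: integrating the link `(z + e_{q₁}, q₂)` glues `S₁` in; the rung `U(z+e_{q₁},i)` cancels.
[folklore] -/
theorem glueB (hP : 2 ≤ P) (hij : i ≠ j) (hL : 2 ≤ L) (hq2 : q.1.2 ≠ i) (hρ : Continuous ρ)
    (U : Config (TiltedSite d i j (2 * P + 1) (2 * P + 1) L) d G) :
    ∫ s, wA ρ q z (update U (z + tiltedUnit d i j (2 * P + 1) (2 * P + 1) L q.1.1, q.1.2) s) *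
        plaqObs ρ (tiltedUnit d i j (2 * P + 1) (2 * P + 1) L) (stand q (z + tiltedUnit d i j (2 * P + 1) (2 * P + 1) L q.1.1, q.1.2))
          (update U (z + tiltedUnit d i j (2 * P + 1) (2 * P + 1) L q.1.1, q.1.2) s)
        ∂haarProbability G = c₁ * wB ρ q z U := by
  have hq12 : q.1.1 ≠ q.1.2 := ne_of_lt q.2
  have he := tiltedUnit_ne_zero_all (d := d) hP hij hL
  set y₁ := z + tiltedUnit d i j (2 * P + 1) (2 * P + 1) L q.1.1 with hy₁
  have n1 : ((z, i) : Link _ d) ≠ (y₁, q.1.2) := fun h => hq2 (Prod.mk.inj h).2.symm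
  have n2 : ((z + tiltedUnit d i j (2 * P + 1) (2 * P + 1) L i, q.1.1) : Link _ d) ≠ (y₁, q.1.2) := fun h => hq12 (Prod.mk.inj h).2
  have n3 : ((y₁, i) : Link _ d) ≠ (y₁, q.1.2) := fun h => hq2 (Prod.mk.inj h).2.symm
  have n4 : ((z + tiltedUnit d i j (2 * P + 1) (2 * P + 1) L q.1.2, q.1.1) : Link _ d) ≠ (y₁, q.1.2) := fun h => hq12 (Prod.mk.inj h).2
  have n5 : ((z, q.1.2) : Link _ d) ≠ (y₁, q.1.2) := fun h => he q.1.1 (by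
    have := (Prod.mk.inj h).1; rw [hy₁] at this; simpa using this.symm)
  have n6 : ((y₁ + tiltedUnit d i j (2 * P + 1) (2 * P + 1) L i, q.1.2) : Link _ d) ≠ (y₁, q.1.2) :=
    link_ne_of_axisCoord_ne (axisCoord_add_self_ne hP y₁)
  have n7 : ((y₁ + tiltedUnit d i j (2 * P + 1) (2 * P + 1) L q.1.2, i) : Link _ d) ≠ (y₁, q.1.2) := fun h => hq2 (Prod.mk.inj h).2.symm
  unfold wA
  simp_rw [← hy₁, plaqObs_stand_eq ρ q hρ y₁ hq2, update_self, update_of_ne n1, update_of_ne n2, update_of_ne n3,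
    update_of_ne n4, update_of_ne n5, update_of_ne n6, update_of_ne n7]
  have hrot : ∀ s : G, reTr ρ (U (z, i) * U (z + tiltedUnit d i j (2 * P + 1) (2 * P + 1) L i, q.1.1) * (U (y₁, i))⁻¹ * s *
      (U (z + tiltedUnit d i j (2 * P + 1) (2 * P + 1) L q.1.2, q.1.1))⁻¹ * (U (z, q.1.2))⁻¹) =
      reTr ρ (s * ((U (z + tiltedUnit d i j (2 * P + 1) (2 * P + 1) L q.1.2, q.1.1))⁻¹ * (U (z, q.1.2))⁻¹ *
        (U (z, i) * U (z + tiltedUnit d i j (2 * P + 1) (2 * P + 1) L i, q.1.1) * (U (y₁, i))⁻¹))) := by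
    intro s
    rw [show U (z, i) * U (z + tiltedUnit d i j (2 * P + 1) (2 * P + 1) L i, q.1.1) * (U (y₁, i))⁻¹ * s *
        (U (z + tiltedUnit d i j (2 * P + 1) (2 * P + 1) L q.1.2, q.1.1))⁻¹ * (U (z, q.1.2))⁻¹ =
        (U (z, i) * U (z + tiltedUnit d i j (2 * P + 1) (2 * P + 1) L i, q.1.1) * (U (y₁, i))⁻¹) *
          (s * ((U (z + tiltedUnit d i j (2 * P + 1) (2 * P + 1) L q.1.2, q.1.1))⁻¹ * (U (z, q.1.2))⁻¹)) by group,
      DiagRPSUN.reTr_mul_comm]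
    congr 1; group
  simp_rw [hrot]
  rw [RedSite.integral_reTr_swap ρ hR1]
  unfold wB
  simp only [hy₁]
  rw [show U (z + tiltedUnit d i j (2 * P + 1) (2 * P + 1) L q.1.1, i) * U (z + tiltedUnit d i j (2 * P + 1) (2 * P + 1) L q.1.1 + tiltedUnit d i j (2 * P + 1) (2 * P + 1) L i, q.1.2) *
      (U (z + tiltedUnit d i j (2 * P + 1) (2 * P + 1) L q.1.1 + tiltedUnit d i j (2 * P + 1) (2 * P + 1) L q.1.2, i))⁻¹ *
      ((U (z + tiltedUnit d i j (2 * P + 1) (2 * P + 1) L q.1.2, q.1.1))⁻¹ * (U (z, q.1.2))⁻¹ *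
        (U (z, i) * U (z + tiltedUnit d i j (2 * P + 1) (2 * P + 1) L i, q.1.1) * (U (z + tiltedUnit d i j (2 * P + 1) (2 * P + 1) L q.1.1, i))⁻¹)) =
      U (z + tiltedUnit d i j (2 * P + 1) (2 * P + 1) L q.1.1, i) * (U (z + tiltedUnit d i j (2 * P + 1) (2 * P + 1) L q.1.1 + tiltedUnit d i j (2 * P + 1) (2 * P + 1) L i, q.1.2) *
        (U (z + tiltedUnit d i j (2 * P + 1) (2 * P + 1) L q.1.1 + tiltedUnit d i j (2 * P + 1) (2 * P + 1) L q.1.2, i))⁻¹ *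
        (U (z + tiltedUnit d i j (2 * P + 1) (2 * P + 1) L q.1.2, q.1.1))⁻¹ * (U (z, q.1.2))⁻¹ * U (z, i) * U (z + tiltedUnit d i j (2 * P + 1) (2 * P + 1) L i, q.1.1)) *
      (U (z + tiltedUnit d i j (2 * P + 1) (2 * P + 1) L q.1.1, i))⁻¹ by group]
  unfold reTr
  rw [CompactGroup.trace_conj_eq]

omit [NeZero L] [NeZero P] [SecondCountableTopology G] in
include hR1 in
/-- **Step C**: integrating the link `(z + e_{q₂}, q₁)` glues `S₂` in (read backward by both words, so
one of them is inverted first); the rung `U(z+e_{q₁}+e_{q₂},i)` cancels. [folklore] -/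
theorem glueC (hP : 2 ≤ P) (hij : i ≠ j) (hL : 2 ≤ L) (hq1 : q.1.1 ≠ i) (hq2 : q.1.2 ≠ i) (hρ : Continuous ρ)
    (U : Config (TiltedSite d i j (2 * P + 1) (2 * P + 1) L) d G) :
    ∫ s, wB ρ q z (update U (z + tiltedUnit d i j (2 * P + 1) (2 * P + 1) L q.1.2, q.1.1) s) *
        plaqObs ρ (tiltedUnit d i j (2 * P + 1) (2 * P + 1) L) (stand q (z + tiltedUnit d i j (2 * P + 1) (2 * P + 1) L q.1.2, q.1.1))
          (update U (z + tiltedUnit d i j (2 * P + 1) (2 * P + 1) L q.1.2, q.1.1) s)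
        ∂haarProbability G = c₁ * wC ρ q z U := by
  have hq12 : q.1.1 ≠ q.1.2 := ne_of_lt q.2
  have he := tiltedUnit_ne_zero_all (d := d) hP hij hL
  set y₂ := z + tiltedUnit d i j (2 * P + 1) (2 * P + 1) L q.1.2 with hy₂
  have hcomm : z + tiltedUnit d i j (2 * P + 1) (2 * P + 1) L q.1.1 + tiltedUnit d i j (2 * P + 1) (2 * P + 1) L q.1.2 =
      y₂ + tiltedUnit d i j (2 * P + 1) (2 * P + 1) L q.1.1 := by rw [hy₂]; abel
  have n1 : ((z, i) : Link _ d) ≠ (y₂, q.1.1) := fun h => hq1 (Prod.mk.inj h).2.symm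
  have n2 : ((z + tiltedUnit d i j (2 * P + 1) (2 * P + 1) L i, q.1.1) : Link _ d) ≠ (y₂, q.1.1) := fun h => by
    have h1 := congrArg (axisCoord d L (2 * P + 1)) (Prod.mk.inj h).1
    rw [hy₂, axisCoord_add_of_ne z hq2] at h1
    exact axisCoord_add_self_ne hP z h1
  have n3 : ((z + tiltedUnit d i j (2 * P + 1) (2 * P + 1) L q.1.1 + tiltedUnit d i j (2 * P + 1) (2 * P + 1) L i, q.1.2) : Link _ d) ≠
      (y₂, q.1.1) := fun h => hq12 (Prod.mk.inj h).2.symm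
  have n4 : ((y₂ + tiltedUnit d i j (2 * P + 1) (2 * P + 1) L q.1.1, i) : Link _ d) ≠ (y₂, q.1.1) := fun h => hq1 (Prod.mk.inj h).2.symm
  have n5 : ((z, q.1.2) : Link _ d) ≠ (y₂, q.1.1) := fun h => hq12 (Prod.mk.inj h).2.symm
  have n6 : ((y₂, i) : Link _ d) ≠ (y₂, q.1.1) := fun h => hq1 (Prod.mk.inj h).2.symm
  have n7 : ((y₂ + tiltedUnit d i j (2 * P + 1) (2 * P + 1) L i, q.1.1) : Link _ d) ≠ (y₂, q.1.1) :=
    link_ne_of_axisCoord_ne (axisCoord_add_self_ne hP y₂)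
  unfold wB
  simp_rw [hcomm, ← hy₂, plaqObs_stand_eq ρ q hρ y₂ hq1, update_self, update_of_ne n1, update_of_ne n2, update_of_ne n3,
    update_of_ne n4, update_of_ne n5, update_of_ne n6, update_of_ne n7]
  -- both words read the link backward: invert the standing one
  have hinv : ∀ s : G, reTr ρ (U (y₂, i) * U (y₂ + tiltedUnit d i j (2 * P + 1) (2 * P + 1) L i, q.1.1) *
      (U (y₂ + tiltedUnit d i j (2 * P + 1) (2 * P + 1) L q.1.1, i))⁻¹ * s⁻¹) =
      reTr ρ (s * (U (y₂ + tiltedUnit d i j (2 * P + 1) (2 * P + 1) L q.1.1, i) *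
        (U (y₂ + tiltedUnit d i j (2 * P + 1) (2 * P + 1) L i, q.1.1))⁻¹ * (U (y₂, i))⁻¹)) := by
    intro s
    rw [show s * (U (y₂ + tiltedUnit d i j (2 * P + 1) (2 * P + 1) L q.1.1, i) *
        (U (y₂ + tiltedUnit d i j (2 * P + 1) (2 * P + 1) L i, q.1.1))⁻¹ * (U (y₂, i))⁻¹) =
        (U (y₂, i) * U (y₂ + tiltedUnit d i j (2 * P + 1) (2 * P + 1) L i, q.1.1) *
          (U (y₂ + tiltedUnit d i j (2 * P + 1) (2 * P + 1) L q.1.1, i))⁻¹ * s⁻¹)⁻¹ by group]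
    exact (CompactGroup.re_trace_map_inv ρ hρ _).symm
  have hrot : ∀ s : G, reTr ρ (U (z + tiltedUnit d i j (2 * P + 1) (2 * P + 1) L q.1.1 + tiltedUnit d i j (2 * P + 1) (2 * P + 1) L i, q.1.2) *
      (U (y₂ + tiltedUnit d i j (2 * P + 1) (2 * P + 1) L q.1.1, i))⁻¹ * s⁻¹ * (U (z, q.1.2))⁻¹ * U (z, i) * U (z + tiltedUnit d i j (2 * P + 1) (2 * P + 1) L i, q.1.1)) =
      reTr ρ (((U (z, q.1.2))⁻¹ * U (z, i) * U (z + tiltedUnit d i j (2 * P + 1) (2 * P + 1) L i, q.1.1) *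
        U (z + tiltedUnit d i j (2 * P + 1) (2 * P + 1) L q.1.1 + tiltedUnit d i j (2 * P + 1) (2 * P + 1) L i, q.1.2) * (U (y₂ + tiltedUnit d i j (2 * P + 1) (2 * P + 1) L q.1.1, i))⁻¹) * s⁻¹) := by
    intro s
    rw [show U (z + tiltedUnit d i j (2 * P + 1) (2 * P + 1) L q.1.1 + tiltedUnit d i j (2 * P + 1) (2 * P + 1) L i, q.1.2) * (U (y₂ + tiltedUnit d i j (2 * P + 1) (2 * P + 1) L q.1.1, i))⁻¹ * s⁻¹ * (U (z, q.1.2))⁻¹ *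
        U (z, i) * U (z + tiltedUnit d i j (2 * P + 1) (2 * P + 1) L i, q.1.1) =
        (U (z + tiltedUnit d i j (2 * P + 1) (2 * P + 1) L q.1.1 + tiltedUnit d i j (2 * P + 1) (2 * P + 1) L i, q.1.2) * (U (y₂ + tiltedUnit d i j (2 * P + 1) (2 * P + 1) L q.1.1, i))⁻¹ * s⁻¹) *
          ((U (z, q.1.2))⁻¹ * U (z, i) * U (z + tiltedUnit d i j (2 * P + 1) (2 * P + 1) L i, q.1.1)) by group,
      DiagRPSUN.reTr_mul_comm]
    congr 1; group
  simp_rw [hinv, hrot]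
  rw [hR1]
  unfold wC
  simp only [hy₂]
  congr 2
  group

omit [NeZero L] [NeZero P] [SecondCountableTopology G] in
include hR1 in
/-- **Step D**: integrating the last link `(z, q₂)` glues `S₃` in; the rungs cancel and the base rung
drops by conjugation invariance, leaving the RING plaquette `(z + e_i; q)`. [folklore] -/
theorem glueD (hP : 2 ≤ P) (hij : i ≠ j) (hL : 2 ≤ L) (hq1 : q.1.1 ≠ i) (hq2 : q.1.2 ≠ i) (hρ : Continuous ρ)
    (U : Config (TiltedSite d i j (2 * P + 1) (2 * P + 1) L) d G) :
    ∫ s, wC ρ q z (update U (z, q.1.2) s) *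
        plaqObs ρ (tiltedUnit d i j (2 * P + 1) (2 * P + 1) L) (stand q (z, q.1.2)) (update U (z, q.1.2) s)
        ∂haarProbability G =
      c₁ * plaqObs ρ (tiltedUnit d i j (2 * P + 1) (2 * P + 1) L) (z + tiltedUnit d i j (2 * P + 1) (2 * P + 1) L i, q) U := by
  have hq12 : q.1.1 ≠ q.1.2 := ne_of_lt q.2
  have he := tiltedUnit_ne_zero_all (d := d) hP hij hL
  have n1 : ((z, i) : Link _ d) ≠ (z, q.1.2) := fun h => hq2 (Prod.mk.inj h).2.symm
  have n2 : ((z + tiltedUnit d i j (2 * P + 1) (2 * P + 1) L i, q.1.1) : Link _ d) ≠ (z, q.1.2) := fun h => hq12 (Prod.mk.inj h).2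
  have n3 : ((z + tiltedUnit d i j (2 * P + 1) (2 * P + 1) L q.1.1 + tiltedUnit d i j (2 * P + 1) (2 * P + 1) L i, q.1.2) : Link _ d) ≠
      (z, q.1.2) := fun h => by
    have h1 := congrArg (axisCoord d L (2 * P + 1)) (Prod.mk.inj h).1
    rw [map_add, axisCoord_add_of_ne z hq1, ← map_add] at h1
    exact axisCoord_add_self_ne hP z h1
  have n4 : ((z + tiltedUnit d i j (2 * P + 1) (2 * P + 1) L q.1.2 + tiltedUnit d i j (2 * P + 1) (2 * P + 1) L i, q.1.1) : Link _ d) ≠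
      (z, q.1.2) := fun h => hq12 (Prod.mk.inj h).2
  have n5 : ((z + tiltedUnit d i j (2 * P + 1) (2 * P + 1) L q.1.2, i) : Link _ d) ≠ (z, q.1.2) := fun h => hq2 (Prod.mk.inj h).2.symm
  have n6 : ((z + tiltedUnit d i j (2 * P + 1) (2 * P + 1) L i, q.1.2) : Link _ d) ≠ (z, q.1.2) :=
    link_ne_of_axisCoord_ne (axisCoord_add_self_ne hP z)
  unfold wC
  simp_rw [plaqObs_stand_eq ρ q hρ z hq2, update_self, update_of_ne n1, update_of_ne n2, update_of_ne n3,
    update_of_ne n4, update_of_ne n5, update_of_ne n6]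
  have hinv : ∀ s : G, reTr ρ (U (z, i) * U (z + tiltedUnit d i j (2 * P + 1) (2 * P + 1) L i, q.1.2) *
      (U (z + tiltedUnit d i j (2 * P + 1) (2 * P + 1) L q.1.2, i))⁻¹ * s⁻¹) =
      reTr ρ (s * (U (z + tiltedUnit d i j (2 * P + 1) (2 * P + 1) L q.1.2, i) *
        (U (z + tiltedUnit d i j (2 * P + 1) (2 * P + 1) L i, q.1.2))⁻¹ * (U (z, i))⁻¹)) := by
    intro s
    rw [show s * (U (z + tiltedUnit d i j (2 * P + 1) (2 * P + 1) L q.1.2, i) *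
        (U (z + tiltedUnit d i j (2 * P + 1) (2 * P + 1) L i, q.1.2))⁻¹ * (U (z, i))⁻¹) =
        (U (z, i) * U (z + tiltedUnit d i j (2 * P + 1) (2 * P + 1) L i, q.1.2) *
          (U (z + tiltedUnit d i j (2 * P + 1) (2 * P + 1) L q.1.2, i))⁻¹ * s⁻¹)⁻¹ by group]
    exact (CompactGroup.re_trace_map_inv ρ hρ _).symm
  have hrot : ∀ s : G, reTr ρ (s⁻¹ * U (z, i) * U (z + tiltedUnit d i j (2 * P + 1) (2 * P + 1) L i, q.1.1) *
      U (z + tiltedUnit d i j (2 * P + 1) (2 * P + 1) L q.1.1 + tiltedUnit d i j (2 * P + 1) (2 * P + 1) L i, q.1.2) *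
      (U (z + tiltedUnit d i j (2 * P + 1) (2 * P + 1) L q.1.2 + tiltedUnit d i j (2 * P + 1) (2 * P + 1) L i, q.1.1))⁻¹ *
      (U (z + tiltedUnit d i j (2 * P + 1) (2 * P + 1) L q.1.2, i))⁻¹) =
      reTr ρ (U (z, i) * U (z + tiltedUnit d i j (2 * P + 1) (2 * P + 1) L i, q.1.1) *
        U (z + tiltedUnit d i j (2 * P + 1) (2 * P + 1) L q.1.1 + tiltedUnit d i j (2 * P + 1) (2 * P + 1) L i, q.1.2) *
        (U (z + tiltedUnit d i j (2 * P + 1) (2 * P + 1) L q.1.2 + tiltedUnit d i j (2 * P + 1) (2 * P + 1) L i, q.1.1))⁻¹ *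
        (U (z + tiltedUnit d i j (2 * P + 1) (2 * P + 1) L q.1.2, i))⁻¹ * s⁻¹) := by
    intro s
    rw [show s⁻¹ * U (z, i) * U (z + tiltedUnit d i j (2 * P + 1) (2 * P + 1) L i, q.1.1) *
        U (z + tiltedUnit d i j (2 * P + 1) (2 * P + 1) L q.1.1 + tiltedUnit d i j (2 * P + 1) (2 * P + 1) L i, q.1.2) *
        (U (z + tiltedUnit d i j (2 * P + 1) (2 * P + 1) L q.1.2 + tiltedUnit d i j (2 * P + 1) (2 * P + 1) L i, q.1.1))⁻¹ *
        (U (z + tiltedUnit d i j (2 * P + 1) (2 * P + 1) L q.1.2, i))⁻¹ =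
        s⁻¹ * (U (z, i) * U (z + tiltedUnit d i j (2 * P + 1) (2 * P + 1) L i, q.1.1) *
          U (z + tiltedUnit d i j (2 * P + 1) (2 * P + 1) L q.1.1 + tiltedUnit d i j (2 * P + 1) (2 * P + 1) L i, q.1.2) *
          (U (z + tiltedUnit d i j (2 * P + 1) (2 * P + 1) L q.1.2 + tiltedUnit d i j (2 * P + 1) (2 * P + 1) L i, q.1.1))⁻¹ *
          (U (z + tiltedUnit d i j (2 * P + 1) (2 * P + 1) L q.1.2, i))⁻¹) by group, DiagRPSUN.reTr_mul_comm]
  simp_rw [hinv, hrot]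
  rw [hR1, plaqObs_transverse_eq]
  -- the glued word is the ring conjugated by the base rung
  rw [show U (z, i) * U (z + tiltedUnit d i j (2 * P + 1) (2 * P + 1) L i, q.1.1) *
      U (z + tiltedUnit d i j (2 * P + 1) (2 * P + 1) L q.1.1 + tiltedUnit d i j (2 * P + 1) (2 * P + 1) L i, q.1.2) *
      (U (z + tiltedUnit d i j (2 * P + 1) (2 * P + 1) L q.1.2 + tiltedUnit d i j (2 * P + 1) (2 * P + 1) L i, q.1.1))⁻¹ *
      (U (z + tiltedUnit d i j (2 * P + 1) (2 * P + 1) L q.1.2, i))⁻¹ *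
      (U (z + tiltedUnit d i j (2 * P + 1) (2 * P + 1) L q.1.2, i) * (U (z + tiltedUnit d i j (2 * P + 1) (2 * P + 1) L i, q.1.2))⁻¹ *
        (U (z, i))⁻¹) =
      U (z, i) * (U (z + tiltedUnit d i j (2 * P + 1) (2 * P + 1) L i, q.1.1) *
        U (z + tiltedUnit d i j (2 * P + 1) (2 * P + 1) L q.1.1 + tiltedUnit d i j (2 * P + 1) (2 * P + 1) L i, q.1.2) *
        (U (z + tiltedUnit d i j (2 * P + 1) (2 * P + 1) L q.1.2 + tiltedUnit d i j (2 * P + 1) (2 * P + 1) L i, q.1.1))⁻¹ *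
        (U (z + tiltedUnit d i j (2 * P + 1) (2 * P + 1) L i, q.1.2))⁻¹) * (U (z, i))⁻¹ by group]
  unfold reTr
  rw [CompactGroup.trace_conj_eq, add_right_comm z (tiltedUnit d i j (2 * P + 1) (2 * P + 1) L q.1.1),
    add_right_comm z (tiltedUnit d i j (2 * P + 1) (2 * P + 1) L q.1.2)]

end Glue

end RedLink

end TiltedRP

end Summit.QuantumFields.GaugeBoot

end
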